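import Mathlib.Combinatorics.SimpleGraph.Connectivity.Connected
import Mathlib.Data.Finset.Card
import HarnessLib

/-!
# A two-coloured simple cycle with at most two bichromatic edges has connected colour classes
# (line `potential-darboux-picard-diamond`, S1c `stub_diamondArcsConnected`, part 1: the abstract lap lemma)

Crux `ParafermionToSLESixFamilies` (stmt-CriticalPhenomena-11389), line `potential-darboux-picard-diamond`, stub
`stub_diamondArcsConnected` (S1c). The discrete boundary of the diamond discretisation is a simple lattice cycle
(plus pendant apexes); admissibility colours its sites by the two discrete arcs `A`, `B` with exactly two `A`–`B`
edges of `Ω_δ`. This file proves the purely combinatorial heart of the connectivity of the arcs: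

* `diamondArcs_reachable_of_lap` (registered helper) — let `V 0, …, V N = V 0` (`N ≥ 3`) be a closed walk of a
  simple graph `G` with consecutive sites adjacent and `V` injective on `[0, N)`, every site coloured `A` or `B`
  (disjoint classes), and suppose no three distinct `A`–`B` edges of `G` exist (every finite set of such edges has
  at most two elements). Then any two `A`-sites of the walk are joined inside `G.induce A`.

Proof: the two arcs of the cycle between two `A`-sites; an arc with a colour switch has two (parity), so if both
arcs switch there are three distinct switch positions, whose edges are three distinct `A`–`B` edges (injectivity).
Elementary; nothing cited.
-/

namespace Summit.CriticalPhenomena.CardyFormulaZ2.Cruxes.ParafermionToSLESixFamilies.PotentialDarbouxPicardDiamond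

namespace ArcsConn

variable {α : Type*} {G : SimpleGraph α} {A B : Set α} {V : ℕ → α} {N : ℕ}

/-- Without a switch at `k`, the two consecutive sites have the same colour. -/
theorem mem_iff_of_not_isSwitch (hAB : Disjoint A B) {k : ℕ} (hk : V k ∈ A ∪ B) (hk1 : V (k + 1) ∈ A ∪ B)
    (hs : ¬ ((V k ∈ A ∧ V (k + 1) ∈ B) ∨ (V k ∈ B ∧ V (k + 1) ∈ A))) :
    (V k ∈ A ↔ V (k + 1) ∈ A) := by
  simp only [not_or, not_and] at hs
  rcases hk with hk | hk <;> rcases hk1 with hk1 | hk1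
  · exact ⟨fun _ => hk1, fun _ => hk⟩
  · exact absurd hk1 (hs.1 hk)
  · exact absurd hk1 (hs.2 hk)
  · exact ⟨fun h => (hAB.ne_of_mem h hk rfl).elim, fun h => (hAB.ne_of_mem h hk1 rfl).elim⟩

/-- Without switches on `[m, m + t)`, the endpoints `V m`, `V (m + t)` have the same colour. -/
theorem mem_iff_of_forall_not_isSwitch (hAB : Disjoint A B) (hmem : ∀ i, i ≤ N → V i ∈ A ∪ B) {m : ℕ} :
    ∀ {t : ℕ}, m + t ≤ N →
      (∀ k, m ≤ k → k < m + t → ¬ ((V k ∈ A ∧ V (k + 1) ∈ B) ∨ (V k ∈ B ∧ V (k + 1) ∈ A))) →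
      (V m ∈ A ↔ V (m + t) ∈ A) := by
  intro t
  induction t with
  | zero => intro _ _; simp
  | succ t ih =>
    intro hmt hs
    have h1 : V m ∈ A ↔ V (m + t) ∈ A := ih (by omega) fun k hk hk' => hs k hk (by omega)
    rw [h1, ← add_assoc]
    exact mem_iff_of_not_isSwitch hAB (hmem _ (by omega)) (hmem _ (by omega)) (hs _ (by omega) (by omega))

/-- With a switch somewhere on `[m, n)`: the contrapositive, existence of a switch from a colour change. -/
theorem exists_isSwitch_of_ne (hAB : Disjoint A B) (hmem : ∀ i, i ≤ N → V i ∈ A ∪ B) {m n : ℕ} (hmn : m ≤ n)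
    (hn : n ≤ N) (hne : ¬ (V m ∈ A ↔ V n ∈ A)) :
    ∃ k, m ≤ k ∧ k < n ∧ ((V k ∈ A ∧ V (k + 1) ∈ B) ∨ (V k ∈ B ∧ V (k + 1) ∈ A)) := by
  by_contra h
  obtain ⟨t, rfl⟩ := Nat.exists_eq_add_of_le hmn
  exact hne (mem_iff_of_forall_not_isSwitch hAB hmem hn fun k hk hk' hs => h ⟨k, hk, hk', hs⟩)

/-- Without switches on `[m, m + t)` and `V m ∈ A`, the whole stretch lies in `A`. -/
theorem forall_mem_of_forall_not_isSwitch (hAB : Disjoint A B) (hmem : ∀ i, i ≤ N → V i ∈ A ∪ B) {m t : ℕ}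
    (hmt : m + t ≤ N) (hs : ∀ k, m ≤ k → k < m + t → ¬ ((V k ∈ A ∧ V (k + 1) ∈ B) ∨ (V k ∈ B ∧ V (k + 1) ∈ A)))
    (hm : V m ∈ A) : ∀ k, k ≤ t → V (m + k) ∈ A := fun k hk =>
  (mem_iff_of_forall_not_isSwitch hAB hmem (t := k) (by omega) fun k' h1 h2 => hs k' h1 (by omega)).1 hm

/-- A stretch of the walk inside `A` joins its endpoints in `G.induce A`. -/
theorem reachable_of_forall_mem (hadj : ∀ i, i < N → G.Adj (V i) (V (i + 1))) {m : ℕ} :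
    ∀ {t : ℕ} (hmt : m + t ≤ N) (hall : ∀ k, k ≤ t → V (m + k) ∈ A),
      (G.induce A).Reachable ⟨V m, by simpa using hall 0 (Nat.zero_le _)⟩ ⟨V (m + t), hall t le_rfl⟩ := by
  intro t
  induction t with
  | zero => intro _ _; exact SimpleGraph.Reachable.refl _
  | succ t ih =>
    intro hmt hall
    have h1 := ih (by omega) fun k hk => hall k (by omega)
    refine h1.trans (SimpleGraph.Adj.reachable ?_)
    rw [SimpleGraph.induce_adj]
    simpa [add_assoc] using hadj (m + t) (by omega)

/-- A switching stretch between two `A`-sites switches at least twice. -/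
theorem exists_two_isSwitch (hAB : Disjoint A B) (hmem : ∀ i, i ≤ N → V i ∈ A ∪ B) {m n : ℕ}
    (hn : n ≤ N) (hm : V m ∈ A) (hnA : V n ∈ A)
    (h : ∃ k, m ≤ k ∧ k < n ∧ ((V k ∈ A ∧ V (k + 1) ∈ B) ∨ (V k ∈ B ∧ V (k + 1) ∈ A))) :
    ∃ k₁ k₂, m ≤ k₁ ∧ k₁ < k₂ ∧ k₂ < n ∧ ((V k₁ ∈ A ∧ V (k₁ + 1) ∈ B) ∨ (V k₁ ∈ B ∧ V (k₁ + 1) ∈ A)) ∧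
      ((V k₂ ∈ A ∧ V (k₂ + 1) ∈ B) ∨ (V k₂ ∈ B ∧ V (k₂ + 1) ∈ A)) := by
  obtain ⟨k, hmk, hkn, hk⟩ := h
  rcases hk with ⟨hkA, hkB⟩ | ⟨hkB, hkA⟩
  · -- `A → B` at `k`: another switch on `[k + 1, n)`
    have hne : ¬ (V (k + 1) ∈ A ↔ V n ∈ A) := fun h' => hAB.ne_of_mem (h'.2 hnA) hkB rfl
    obtain ⟨k₂, h1, h2, h3⟩ := exists_isSwitch_of_ne hAB hmem (by omega) hn hne
    exact ⟨k, k₂, hmk, by omega, h2, Or.inl ⟨hkA, hkB⟩, h3⟩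
  · -- `B → A` at `k`: another switch on `[m, k)`
    have hne : ¬ (V m ∈ A ↔ V k ∈ A) := fun h' => hAB.ne_of_mem (h'.1 hm) hkB rfl
    obtain ⟨k₁, h1, h2, h3⟩ := exists_isSwitch_of_ne hAB hmem hmk (by omega) hne
    exact ⟨k₁, k, h1, h2, hkn, h3, Or.inr ⟨hkB, hkA⟩⟩

/-- The edge of a switch is an `A`–`B` edge of `G`. -/
theorem isAB_of_isSwitch (hadj : ∀ i, i < N → G.Adj (V i) (V (i + 1))) {k : ℕ} (hk : k < N)
    (hs : ((V k ∈ A ∧ V (k + 1) ∈ B) ∨ (V k ∈ B ∧ V (k + 1) ∈ A))) :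
    s(V k, V (k + 1)) ∈ G.edgeSet ∧ (∃ x ∈ s(V k, V (k + 1)), x ∈ A) ∧ ∃ y ∈ s(V k, V (k + 1)), y ∈ B := by
  refine ⟨(SimpleGraph.mem_edgeSet G).2 (hadj k hk), ?_, ?_⟩
  · rcases hs with ⟨h, -⟩ | ⟨-, h⟩
    · exact ⟨V k, Sym2.mem_mk_left _ _, h⟩
    · exact ⟨V (k + 1), Sym2.mem_mk_right _ _, h⟩
  · rcases hs with ⟨-, h⟩ | ⟨h, -⟩
    · exact ⟨V (k + 1), Sym2.mem_mk_right _ _, h⟩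
    · exact ⟨V k, Sym2.mem_mk_left _ _, h⟩

/-- On a simple closed walk (`V` injective on `[0, N)`, `V N = V 0`, `N ≥ 3`) distinct positions carry distinct
edges. -/
theorem edge_ne_of_ne (hN : 3 ≤ N) (hcl : V N = V 0) (hinj : ∀ i j, i < j → j < N → V i ≠ V j) {k k' : ℕ}
    (hk : k < N) (hk' : k' < N) (hne : k ≠ k') : s(V k, V (k + 1)) ≠ s(V k', V (k' + 1)) := by
  -- values at positions `≤ N`, reduced to `[0, N)`
  have hval : ∀ i, i ≤ N → ∃ i', i' < N ∧ V i = V i' ∧ (i' = i ∨ (i = N ∧ i' = 0)) := by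
    intro i hi
    rcases Nat.lt_or_ge i N with h | h
    · exact ⟨i, h, rfl, Or.inl rfl⟩
    · exact ⟨0, by omega, by rw [show i = N by omega, hcl], Or.inr ⟨by omega, rfl⟩⟩
  have key : ∀ i j, i < N → j < N → V i = V j → i = j := by
    intro i j hi hj h
    by_contra hij
    rcases Nat.lt_or_gt_of_ne hij with h' | h'
    · exact hinj i j h' hj h
    · exact hinj j i h' hi h.symm
  intro h
  rw [Sym2.eq_iff] at h
  rcases h with ⟨h1, -⟩ | ⟨h1, h2⟩
  · exact hne (key k k' hk hk' h1)
  · obtain ⟨p, hp, hpV, hp'⟩ := hval (k' + 1) (by omega)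
    obtain ⟨q, hq, hqV, hq'⟩ := hval (k + 1) (by omega)
    have e1 := key k p hk hp (h1.trans hpV)
    have e2 := key q k' hq hk' (hqV.symm.trans h2)
    omega

/-- **The lap lemma.** On a simple closed two-coloured walk with no three distinct `A`–`B` edges, any two
`A`-sites are joined inside `G.induce A`. -/
theorem reachable_of_lap (hN : 3 ≤ N) (hAB : Disjoint A B) (hmem : ∀ i, i ≤ N → V i ∈ A ∪ B)
    (hadj : ∀ i, i < N → G.Adj (V i) (V (i + 1))) (hcl : V N = V 0)
    (hinj : ∀ i j, i < j → j < N → V i ≠ V j)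
    (htwo : ∀ S : Finset (Sym2 α),
      (∀ e ∈ S, e ∈ G.edgeSet ∧ (∃ x ∈ e, x ∈ A) ∧ ∃ y ∈ e, y ∈ B) → S.card ≤ 2)
    {i j : ℕ} (hiA : V i ∈ A) (hjA : V j ∈ A) (hi : i ≤ N) (hj : j ≤ N) :
    (G.induce A).Reachable ⟨V i, hiA⟩ ⟨V j, hjA⟩ := by
  classical
  -- reduce to `i < j`
  suffices main : ∀ i j (hiA : V i ∈ A) (hjA : V j ∈ A), i < j → j ≤ N →
      (G.induce A).Reachable ⟨V i, hiA⟩ ⟨V j, hjA⟩ by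
    rcases lt_trichotomy i j with h | rfl | h
    · exact main i j hiA hjA h hj
    · exact SimpleGraph.Reachable.refl _
    · exact (main j i hjA hiA h hi).symm
  intro i j hiA hjA hij hj
  by_cases h1 : ∃ k, i ≤ k ∧ k < j ∧ ((V k ∈ A ∧ V (k + 1) ∈ B) ∨ (V k ∈ B ∧ V (k + 1) ∈ A))
  · by_cases h2 : ∃ k, ((j ≤ k ∧ k < N) ∨ k < i) ∧ ((V k ∈ A ∧ V (k + 1) ∈ B) ∨ (V k ∈ B ∧ V (k + 1) ∈ A))
    · -- three distinct switches: contradiction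
      exfalso
      obtain ⟨k₁, k₂, h11, h12, h13, hs1, hs2⟩ := exists_two_isSwitch hAB hmem hj hiA hjA h1
      obtain ⟨k₃, h31, hs3⟩ := h2
      have hk1 : k₁ < N := by omega
      have hk2 : k₂ < N := by omega
      have hk3 : k₃ < N := by omega
      have n12 := edge_ne_of_ne hN hcl hinj hk1 hk2 (by omega)
      have n13 := edge_ne_of_ne hN hcl hinj hk1 hk3 (by omega)
      have n23 := edge_ne_of_ne hN hcl hinj hk2 hk3 (by omega)
      have hcard := htwo {s(V k₁, V (k₁ + 1)), s(V k₂, V (k₂ + 1)), s(V k₃, V (k₃ + 1))} (by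
        intro e he
        simp only [Finset.mem_insert, Finset.mem_singleton] at he
        rcases he with rfl | rfl | rfl
        · exact isAB_of_isSwitch hadj hk1 hs1
        · exact isAB_of_isSwitch hadj hk2 hs2
        · exact isAB_of_isSwitch hadj hk3 hs3)
      have h3 : ({s(V k₁, V (k₁ + 1)), s(V k₂, V (k₂ + 1)), s(V k₃, V (k₃ + 1))} : Finset (Sym2 α)).card = 3 :=
        Finset.card_eq_three.2 ⟨_, _, _, n12, n13, n23, rfl⟩
      omega
    · -- go the other way round: `j → N = 0 → i`
      obtain ⟨t, rfl⟩ := Nat.exists_eq_add_of_le hj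
      have hsj : ∀ k, j ≤ k → k < j + t → ¬ ((V k ∈ A ∧ V (k + 1) ∈ B) ∨ (V k ∈ B ∧ V (k + 1) ∈ A)) :=
        fun k hk hk' hs => h2 ⟨k, Or.inl ⟨hk, hk'⟩, hs⟩
      have hs0 : ∀ k, 0 ≤ k → k < 0 + i → ¬ ((V k ∈ A ∧ V (k + 1) ∈ B) ∨ (V k ∈ B ∧ V (k + 1) ∈ A)) :=
        fun k _ hk' hs => h2 ⟨k, Or.inr (by omega), hs⟩
      have hallj := forall_mem_of_forall_not_isSwitch hAB hmem le_rfl hsj hjA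
      have h0A : V 0 ∈ A := by rw [← hcl]; simpa using hallj t le_rfl
      have hall0 := forall_mem_of_forall_not_isSwitch hAB hmem (m := 0) (t := i) (by omega) hs0 h0A
      have r1 := reachable_of_forall_mem hadj (A := A) le_rfl hallj
      have r2 := reachable_of_forall_mem hadj (A := A) (m := 0) (t := i) (by omega) hall0
      have e1 : (⟨V (j + t), hallj t le_rfl⟩ : A) = ⟨V 0, h0A⟩ := Subtype.ext hcl
      have e2 : (⟨V (0 + i), hall0 i le_rfl⟩ : A) = ⟨V i, hiA⟩ := Subtype.ext (by simp)
      rw [e1] at r1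
      rw [e2] at r2
      exact (r1.trans r2).symm
  · -- direct stretch `i → j`
    obtain ⟨t, rfl⟩ := Nat.exists_eq_add_of_le hij.le
    have hall := forall_mem_of_forall_not_isSwitch hAB hmem hj (fun k hk hk' hs => h1 ⟨k, hk, hk', hs⟩) hiA
    exact reachable_of_forall_mem hadj hj hall

end ArcsConn

/-- **The lap lemma of the diamond arcs** (registered helper of `stub_diamondArcsConnected`). Let `V 0, …, V N = V 0`
(`N ≥ 3`) be a closed walk in a simple graph `G`, consecutive sites adjacent, `V` injective on `[0, N)`, every site in
one of two disjoint classes `A`, `B`, and suppose every finite set of `A`–`B` edges of `G` (edges with an endpoint in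
`A` and one in `B`) has at most two elements. Then any two `A`-sites of the walk are joined inside `G.induce A`. -/
theorem diamondArcs_reachable_of_lap : ∀ {α : Type*} (G : SimpleGraph α) (A B : Set α) (V : ℕ → α) (N : ℕ), 3 ≤ N → Disjoint A B → (∀ i, i ≤ N → V i ∈ A ∪ B) → (∀ i, i < N → G.Adj (V i) (V (i + 1))) → V N = V 0 → (∀ i j, i < j → j < N → V i ≠ V j) → (∀ S : Finset (Sym2 α), (∀ e ∈ S, e ∈ G.edgeSet ∧ (∃ x ∈ e, x ∈ A) ∧ ∃ y ∈ e, y ∈ B) → S.card ≤ 2) → ∀ (i j : ℕ) (hi : V i ∈ A) (hj : V j ∈ A), i ≤ N → j ≤ N → (G.induce A).Reachable ⟨V i, hi⟩ ⟨V j, hj⟩ := by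
  intro α G A B V N hN hAB hmem hadj hcl hinj htwo i j hi hj hiN hjN
  exact ArcsConn.reachable_of_lap hN hAB hmem hadj hcl hinj htwo hi hj hiN hjN

end Summit.CriticalPhenomena.CardyFormulaZ2.Cruxes.ParafermionToSLESixFamilies.PotentialDarbouxPicardDiamond
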